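import Literature.Computability.Complexity.Williams2014AccSat
import Literature.Computability.Complexity.OrOfRestrictions
import Literature.Computability.Complexity.FinitePatchMachines
import Literature.Computability.Complexity.TimeBoundsProofs
import HarnessLib

/-!
# Williams' `ACC`-SAT algorithm (J. ACM 2014, Thm. 4.1): the driver and its time analysis

`Williams2014AccSat.lean` states Williams' Theorem 4.1 (`Williams2014_thm_4_1`, the `ACC`-SAT
algorithm behind `NEXP ⊄ ACC⁰`) and its two printed components, Lemma 4.1 (the algorithmic
`ACC → SYM⁺` conversion, `Williams2014_lemma_4_1`) and Lemma 4.2 (evaluation of a `SYM⁺` circuit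
on all inputs, `Williams2014_lemma_4_2`), as named facts over Mathlib's `TM2`. This file PROVES
the remaining content of the printed proof of Thm. 4.1 — the driver and the parameter analysis —
as a conditional theorem whose hypotheses are exactly machine specifications:

* `exists_accSat_driver` — the **driver**: given a preprocessing machine `P` printing the code of
  the OR `C'` of the `2^ℓ` restrictions of the first `ℓ = ℓ(n)` inputs
  (`Circuit.orRestrictions`, `OrOfRestrictions.lean`: `C` is satisfiable iff `C'` is, depth
  `≤ d + 2`, size `2^ℓ (s + 2) + 1`), a conversion machine `M` as in Lemma 4.1 at depth `d + 2`,
  an evaluation machine `E` as in Lemma 4.2 and the linear scan for a `1`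
  (`Com.exists_outputsWithin_any`, `FinitePatchMachines.lean`), their sequential composite
  (`TM2ComputableAux.comp_outputsWithin`, `TimeBoundsProofs.lean`) decides satisfiability of
  every `AC⁰[m]` circuit of depth `≤ d`, within the explicit time `driverTime e cE cP ℓ n s`;
* `driverTime_le`, `driverBound_le_two_pow`, `eventually_driver_conditions`,
  `two_pow_le_floor_rpow` — the **analysis** (p. 16: "Set `ℓ = n^{1/(2e)}`, and observe that
  `s'' ≤ 2^{n^{2/3}}` for all sufficiently large `n` and sufficiently small `ε` … `C''` can be
  evaluated on all of its possible assignments in `O(2^{n-ℓ} · poly(n)) ≤ 2^{n-Ω(n^{1/(2e)})}`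
  time, hence the satisfiability of `C` can be determined within this time"): with `e ≥ 1` the
  exponent of Lemma 4.1, size `s ≤ 2^{n^{1/(4e)}}` and `ℓ ≍ n^{1/(2e)}`, the
  driver's time is at most `2^{n - ℓ/2} ≤ ⌊2^{n - a n^{1/(2e)}}⌋` for all large `n`, the growth
  facts being `(A t + B)^r < 2^t`, `A log₂ (n+1) + B ≤ ⌊n^{1/r}⌋` and `A ⌊√n⌋ + B ≤ n` eventually;
* `Williams2014_thm_4_1_of_machines` — **Theorem 4.1 from its machines**: `Williams2014_lemma_4_1`,
  an evaluation machine correct on every `SYM⁺` circuit within `cE (2ⁿ + s^{cE}) (n+1)^{cE} + cE`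
  steps (Lemma 4.2 in the form Proof 2 yields, without the size hypothesis of Proof 1), a
  restriction-length function within constant factors of `⌊n^{1/r}⌋` and preprocessing machines
  polynomial in `2^ℓ (n + size + fan-in + 2)` together give `Williams2014_thm_4_1` with
  `ε = 1/(4e)`, `δ = 1/(2e)`; `…_nthRoot` is the instance `ℓ = ⌊n^{1/r}⌋`, and
  `Williams2014_accSat_polysize_of_machines` draws the two consequences used in the tree
  (`Williams2014_accSat_polysize`, `MurrayWilliams2018_thm_5_1`).

So the discharge of `Williams2014_thm_4_1` (hence of `Williams2014_accSat_polysize`) is reduced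
to three machine constructions with the displayed specifications: the conversion (Lemma 4.1
with Appendix A), the evaluation (Lemma 4.2, Proof 2 / Appendix C; its mathematics is
`YatesZeta.lean`) and the preprocessing (printing `Circuit.orRestrictions`).

## Faithfulness notes

* Williams takes `ℓ = n^{1/(2e)}` and size `2^{n^ε}` with `ε` small against `1/(2e)`; we take
  `ε = 1/(4e)` and allow any `ℓ(n)` within constant factors of `⌊n^{1/(2e)}⌋` (so that a machine
  may compute, e.g., a power of two near `n^{1/(2e)}`), obtaining the saving `a n^{1/(2e)}` with
  `a = 1/(4(K+1))`, `K` the sandwich constant — a rendering of the printed `Ω(n^δ)`, `δ = 1/(2e)`.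
* The depth of `C'` is `d + 2` in the tree's model (constants are gates), `d + 1` in the paper;
  Lemma 4.1 is applied at depth `d + 2`.
* Small `n` (below the threshold of the analysis or of the size hypothesis) are finitely many
  input lengths, on each of which the driver's time is a fixed number; they are absorbed by the
  additive constant of `AccSatInTime` (`AccSatInTime.of_le_of_bdd`), the driver being correct on
  every instance.

## References

* R. Williams, *Nonuniform ACC circuit lower bounds*, J. ACM 61(1) (2014) 2:1–2:32, §4.3,
  Thm. 4.1 and its proof; Lemma 4.1, Lemma 4.2 [Williams2014].
* S. Arora, B. Barak, *Computational Complexity: A Modern Approach*, CUP 2009, §1.3 (sequential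
  composition of machines) [AroraBarak2009].
-/

namespace Literature.Computability.Complexity

open _root_.Computability Turing MetaComplexity

/-! ### Reading satisfiability off a truth table -/

/-- The OR of the truth table of `f` is `true` iff `f` has a satisfying assignment. [folklore] -/
theorem any_truthTable {n : ℕ} (f : (Fin n → Bool) → Bool) :
    (truthTable f).any id = decide (∃ x, f x = true) := by
  rw [Bool.eq_iff_iff, List.any_eq_true, decide_eq_true_iff]
  constructor
  · rintro ⟨b, hb, hb'⟩
    rw [truthTable, List.mem_ofFn] at hb
    obtain ⟨i, rfl⟩ := hb
    exact ⟨_, hb'⟩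
  · rintro ⟨x, hx⟩
    refine ⟨true, ?_, rfl⟩
    rw [truthTable, List.mem_ofFn]
    exact ⟨boolFunEquivFin n x, by simpa using hx⟩

/-! ### The driver: preprocess, convert, evaluate, scan -/

/-- The size parameter at which the conversion machine of Lemma 4.1 is run on the OR of the
`2^L` restrictions of a circuit with `n` inputs and at most `s` gates of fan-in `≤ s`: a common
bound for its number of inputs `n - L`, its size `2^L (s + 2) + 1` and its fan-in `max s 2^L`.
[cite: Williams2014, Thm. 4.1 (proof)] -/
def driverSize (L n s : ℕ) : ℕ := 2 ^ L * (s + 2) + n + 1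

/-- The running time of the driver of Theorem 4.1 on a circuit with `n` inputs, at most `s` gates
and fan-in `≤ s`, with restriction length `L`, conversion exponent `e` (Lemma 4.1), evaluation
constant `cE` (Lemma 4.2) and preprocessing constant `cP`: scan `+` evaluation `+` conversion `+`
preprocessing, in the order produced by `TM2ComputableAux.comp_outputsWithin`.
[cite: Williams2014, Thm. 4.1 (proof)] -/
def driverTime (e cE cP L n s : ℕ) : ℕ :=
  5 * 2 ^ (n - L) + 5 +
    (cE * (2 ^ (n - L) + (2 ^ (Nat.log 2 (driverSize L n s) + 2) ^ e) ^ cE) * (n - L + 1) ^ cE + cE) +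
    2 ^ (Nat.log 2 (driverSize L n s) + 2) ^ e +
    (cP * (2 ^ L * (n + 2 * s + 2)) ^ cP + cP)

/-- **The driver of Williams' `ACC`-SAT algorithm** (Williams 2014, proof of Thm. 4.1), assembled
by sequential composition from: a preprocessing machine `P` printing the code of the OR `C'` of
the `2^{ℓ(n)}` restrictions of the first `ℓ(n)` inputs (`Circuit.orRestrictions`); a conversion
machine `M` as in Lemma 4.1 (at depth `d + 2`, the depth of `C'`); an evaluation machine `E` as
in Lemma 4.2 (without size hypothesis); and the linear scan for a `1` in the truth table
(`Com.exists_outputsWithin_any`). On every `AC⁰[m]` circuit of depth `≤ d` with `n` inputs, at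
most `s` gates and fan-in `≤ s` it outputs `encodeBool (decide C.Satisfiable)` within
`driverTime e cE cP (ℓ n) n s` steps ("`C` is satisfiable if and only if `C'` is satisfiable …
hence the satisfiability of `C` can be determined"). [cite: Williams2014, Thm. 4.1 (proof)] -/
theorem exists_accSat_driver {d m e cE cP : ℕ} {M E P : TM2ComputableAux Bool Bool} {ℓ : ℕ → ℕ}
    (hM : ∀ (n s : ℕ) (C : Circuit (Fin n)), C.IsOver (accBasis m) → C.acDepth ≤ d + 2 → n ≤ s →
      C.size ≤ s → C.maxFanIn ≤ s →
        ∃ S : SymPlus n, S.size ≤ 2 ^ (Nat.log 2 s + 2) ^ e ∧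
          S.maxFanIn ≤ (Nat.log 2 s + 2) ^ e ∧ (∀ x, S.eval x = C.eval x) ∧
          M.OutputsWithin (encodeAccCircuit m C) (encodeSymPlus S) (2 ^ (Nat.log 2 s + 2) ^ e))
    (hE : ∀ (n : ℕ) (S : SymPlus n), E.OutputsWithin (encodeSymPlus S) (truthTable S.eval)
      (cE * (2 ^ n + S.size ^ cE) * (n + 1) ^ cE + cE))
    (hP : ∀ (n : ℕ) (C : Circuit (Fin n)), C.IsOver (accBasis m) →
      P.OutputsWithin (encodeAccCircuit m C) (encodeAccCircuit m (C.orRestrictions (ℓ n)))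
        (cP * (2 ^ ℓ n * (n + C.size + C.maxFanIn + 2)) ^ cP + cP)) :
    ∃ D : TM2ComputableAux Bool Bool, ∀ (n s : ℕ) (C : Circuit (Fin n)), C.IsOver (accBasis m) →
      C.acDepth ≤ d → C.size ≤ s → C.maxFanIn ≤ s →
        D.OutputsWithin (encodeAccCircuit m C) (encodeBool (decide C.Satisfiable))
          (driverTime e cE cP (ℓ n) n s) := by
  obtain ⟨A, hA⟩ := Com.exists_outputsWithin_any
  refine ⟨P.comp (M.comp (E.comp A)), fun n s C hO hd hs hf => ?_⟩
  have hO' : (C.orRestrictions (ℓ n)).IsOver (accBasis m) :=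
    Circuit.orRestrictions_isOver_accBasis hO (ℓ n)
  have hd' : (C.orRestrictions (ℓ n)).acDepth ≤ d + 2 :=
    (Circuit.acDepth_orRestrictions_le C (ℓ n)).trans (by omega)
  have h2L : 2 ^ ℓ n ≤ 2 ^ ℓ n * (s + 2) := Nat.le_mul_of_pos_right _ (by omega)
  have hsz' : (C.orRestrictions (ℓ n)).size ≤ driverSize (ℓ n) n s := by
    rw [Circuit.size_orRestrictions, driverSize]
    have : 2 ^ ℓ n * (C.size + 2) ≤ 2 ^ ℓ n * (s + 2) := Nat.mul_le_mul_left _ (by omega)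
    omega
  have hfi' : (C.orRestrictions (ℓ n)).maxFanIn ≤ driverSize (ℓ n) n s := by
    refine (Circuit.maxFanIn_orRestrictions_le C (ℓ n)).trans (max_le ?_ ?_)
    · rw [driverSize]
      have : s ≤ 2 ^ ℓ n * (s + 2) :=
        (Nat.le_add_right s 2).trans (Nat.le_mul_of_pos_left _ (Nat.two_pow_pos _))
      omega
    · rw [driverSize]; omega
  have hn' : n - ℓ n ≤ driverSize (ℓ n) n s := by rw [driverSize]; omega
  obtain ⟨S, hSsize, -, hSeval, hMrun⟩ :=
    hM (n - ℓ n) (driverSize (ℓ n) n s) (C.orRestrictions (ℓ n)) hO' hd' hn' hsz' hfi'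
  have hErun := hE (n - ℓ n) S
  have hArun := hA (truthTable S.eval)
  rw [length_truthTable] at hArun
  have hb : [(truthTable S.eval).any id] = encodeBool (decide C.Satisfiable) := by
    rw [any_truthTable]
    change [decide (∃ x, S.eval x = true)] = [decide C.Satisfiable]
    rw [List.singleton_inj, decide_eq_decide]
    simp_rw [hSeval]
    exact Circuit.satisfiable_orRestrictions_iff C (ℓ n)
  rw [hb] at hArun
  have h1 := TM2ComputableAux.comp_outputsWithin E A hErun hArun
  have h2 := TM2ComputableAux.comp_outputsWithin M _ hMrun h1
  have h3 := TM2ComputableAux.comp_outputsWithin P _ (hP n C hO) h2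
  refine h3.mono ?_
  unfold driverTime
  have hcs : n + C.size + C.maxFanIn + 2 ≤ n + 2 * s + 2 := by omega
  gcongr


/-! ### Bounding the driver's running time -/

/-- **Crude form of the driver's time** once the size is subexponential: if `s ≤ 2^{ρ+1}` then
`driverTime e cE cP L n s ≤ G (n+1)^{cE} (2^{n-L} + 2^{G u^e})` with `G = 2cE + 2cP + 11` and
`u = L + ρ + log₂ n + 5` (an upper bound for `log₂` of the size parameter `driverSize L n s`,
plus `2`). [cite: Williams2014, Thm. 4.1 (proof)] -/
theorem driverTime_le {e cE cP L n s ρ : ℕ} (he : 1 ≤ e) (hs : s ≤ 2 ^ (ρ + 1)) :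
    driverTime e cE cP L n s ≤ (2 * cE + 2 * cP + 11) * (n + 1) ^ cE *
      (2 ^ (n - L) + 2 ^ ((2 * cE + 2 * cP + 11) * (L + ρ + Nat.log 2 n + 5) ^ e)) := by
  unfold driverTime
  set G := 2 * cE + 2 * cP + 11 with hG
  set u := L + ρ + Nat.log 2 n + 5 with hu
  set v := Nat.log 2 (driverSize L n s) + 2 with hv
  have hn2 : n < 2 ^ (Nat.log 2 n + 1) := Nat.lt_pow_succ_log_self one_lt_two n
  have h2ρ : 2 ≤ 2 ^ (ρ + 1) := by
    calc (2 : ℕ) = 2 ^ 1 := rfl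
      _ ≤ 2 ^ (ρ + 1) := Nat.pow_le_pow_right two_pos (by omega)
  have hs2 : s + 2 ≤ 2 ^ (ρ + 2) := by rw [pow_succ]; omega
  -- the size parameter is at most `2^(L + ρ + log₂ n + 3)`
  have hDS : driverSize L n s ≤ 2 ^ (L + ρ + Nat.log 2 n + 3) := by
    unfold driverSize
    have h1 : 2 ^ L * (s + 2) ≤ 2 ^ (L + ρ + 2) := by
      rw [show L + ρ + 2 = L + (ρ + 2) by omega, pow_add 2 L (ρ + 2)]
      exact Nat.mul_le_mul_left _ hs2
    have h2 : 2 ^ (L + ρ + 2) ≤ 2 ^ (L + ρ + Nat.log 2 n + 2) :=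
      Nat.pow_le_pow_right two_pos (by omega)
    have h3 : 2 ^ (Nat.log 2 n + 1) ≤ 2 ^ (L + ρ + Nat.log 2 n + 2) :=
      Nat.pow_le_pow_right two_pos (by omega)
    have h4 : 2 ^ (L + ρ + Nat.log 2 n + 3) = 2 * 2 ^ (L + ρ + Nat.log 2 n + 2) := by
      rw [pow_succ]; ring
    omega
  have hvu : v ≤ u := by
    have : Nat.log 2 (driverSize L n s) ≤ L + ρ + Nat.log 2 n + 3 := by
      calc Nat.log 2 (driverSize L n s) ≤ Nat.log 2 (2 ^ (L + ρ + Nat.log 2 n + 3)) :=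
            Nat.log_mono_right hDS
        _ = L + ρ + Nat.log 2 n + 3 := Nat.log_pow one_lt_two _
    omega
  -- the preprocessing parameter is at most `2^u`
  have hW : 2 ^ L * (n + 2 * s + 2) ≤ 2 ^ u := by
    have h1 : n + 2 * s + 2 ≤ 2 ^ (ρ + Nat.log 2 n + 5) := by
      have h5 : 2 * s ≤ 2 ^ (ρ + 2) := by rw [pow_succ]; omega
      have h6 : 2 ^ (ρ + 2) ≤ 2 ^ (ρ + Nat.log 2 n + 4) := Nat.pow_le_pow_right two_pos (by omega)
      have h7 : 8 * 2 ^ (Nat.log 2 n + 1) ≤ 2 ^ (ρ + Nat.log 2 n + 4) := by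
        calc 8 * 2 ^ (Nat.log 2 n + 1) = 2 ^ (Nat.log 2 n + 4) := by
              rw [show Nat.log 2 n + 4 = Nat.log 2 n + 1 + 3 by omega, pow_add]; norm_num; ring
          _ ≤ 2 ^ (ρ + Nat.log 2 n + 4) := Nat.pow_le_pow_right two_pos (by omega)
      have h8 : 2 ^ (ρ + Nat.log 2 n + 5) = 2 * 2 ^ (ρ + Nat.log 2 n + 4) := by
        rw [pow_succ]; ring
      omega
    calc 2 ^ L * (n + 2 * s + 2) ≤ 2 ^ L * 2 ^ (ρ + Nat.log 2 n + 5) := Nat.mul_le_mul_left _ h1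
      _ = 2 ^ u := by rw [← pow_add, hu]; congr 1; omega
  -- everything is a multiple of `T = (n+1)^cE (2^(n-L) + 2^(G u^e))`
  set X := 2 ^ (n - L) with hX
  set Y := 2 ^ (G * u ^ e) with hY
  set Q := (n + 1) ^ cE with hQ
  have hY1 : 1 ≤ Y := Nat.one_le_two_pow
  have hQ1 : 1 ≤ Q := Nat.one_le_pow _ _ (Nat.succ_pos n)
  have huue : u ≤ u ^ e := Nat.le_self_pow (by omega) u
  have hG1 : cE ≤ G := by omega
  have hG2 : cP ≤ G := by omega
  have hG3 : 1 ≤ G := by omega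
  have hMY : 2 ^ v ^ e ≤ Y := by
    refine Nat.pow_le_pow_right two_pos ?_
    calc v ^ e ≤ u ^ e := Nat.pow_le_pow_left hvu e
      _ = 1 * u ^ e := (one_mul _).symm
      _ ≤ G * u ^ e := Nat.mul_le_mul_right _ hG3
  have hEY : (2 ^ v ^ e) ^ cE ≤ Y := by
    rw [← pow_mul]
    refine Nat.pow_le_pow_right two_pos ?_
    calc v ^ e * cE ≤ u ^ e * cE := Nat.mul_le_mul_right _ (Nat.pow_le_pow_left hvu e)
      _ = cE * u ^ e := mul_comm _ _
      _ ≤ G * u ^ e := Nat.mul_le_mul_right _ hG1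
  have hPY : (2 ^ L * (n + 2 * s + 2)) ^ cP ≤ Y := by
    calc (2 ^ L * (n + 2 * s + 2)) ^ cP ≤ (2 ^ u) ^ cP := Nat.pow_le_pow_left hW cP
      _ = 2 ^ (u * cP) := (pow_mul _ _ _).symm
      _ ≤ Y := Nat.pow_le_pow_right two_pos (by
          calc u * cP ≤ u ^ e * cP := Nat.mul_le_mul_right _ huue
            _ = cP * u ^ e := mul_comm _ _
            _ ≤ G * u ^ e := Nat.mul_le_mul_right _ hG2)
  have hQ' : (n - L + 1) ^ cE ≤ Q := Nat.pow_le_pow_left (by omega) cE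
  set T := Q * (X + Y) with hT
  have hT1 : 1 ≤ T := Nat.mul_le_mul hQ1 (le_add_left hY1)
  have hXT : X ≤ T :=
    calc X ≤ X + Y := Nat.le_add_right _ _
      _ = 1 * (X + Y) := (one_mul _).symm
      _ ≤ T := Nat.mul_le_mul_right _ hQ1
  have hYT : Y ≤ T :=
    calc Y ≤ X + Y := Nat.le_add_left _ _
      _ = 1 * (X + Y) := (one_mul _).symm
      _ ≤ T := Nat.mul_le_mul_right _ hQ1
  calc 5 * X + 5 + (cE * (X + (2 ^ v ^ e) ^ cE) * (n - L + 1) ^ cE + cE) + 2 ^ v ^ e +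
        (cP * (2 ^ L * (n + 2 * s + 2)) ^ cP + cP)
      ≤ 5 * X + 5 + (cE * (X + Y) * Q + cE) + Y + (cP * Y + cP) := by
        gcongr
    _ ≤ 5 * T + 5 * T + (cE * T + cE * T) + T + (cP * T + cP * T) := by
        have h5 : 5 ≤ 5 * T := by omega
        have hcE : cE ≤ cE * T := Nat.le_mul_of_pos_right _ hT1
        have hcP : cP ≤ cP * T := Nat.le_mul_of_pos_right _ hT1
        have hcEXY : cE * (X + Y) * Q = cE * T := by rw [hT]; ring
        have h5X : 5 * X ≤ 5 * T := Nat.mul_le_mul_left _ hXT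
        have hcPY : cP * Y ≤ cP * T := Nat.mul_le_mul_left _ hYT
        omega
    _ = G * Q * (X + Y) := by rw [hT, hG]; ring

/-- **From the crude form to `2^{n - L/2}`**: two explicit largeness conditions on `n` and `L`
(`H1`: `L` beats `log n`; `H2`: `n` beats `u^e` and `L`) under which
`G (n+1)^{cE} (2^{n-L} + 2^{G u^e}) ≤ 2^{n - L/2}`. [folklore] -/
theorem driverBound_le_two_pow {G cE L n Z : ℕ} (hL : L ≤ n)
    (H1 : Nat.log 2 G + 1 + cE * (Nat.log 2 (n + 1) + 1) + 1 + L / 2 ≤ L)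
    (H2 : Nat.log 2 G + 1 + cE * (Nat.log 2 (n + 1) + 1) + Z + L / 2 + 1 ≤ n) :
    G * (n + 1) ^ cE * (2 ^ (n - L) + 2 ^ Z) ≤ 2 ^ (n - L / 2) := by
  set g := Nat.log 2 G + 1 with hg
  set q := Nat.log 2 (n + 1) + 1 with hq
  have hGg : G ≤ 2 ^ g := (Nat.lt_pow_succ_log_self one_lt_two G).le
  have hQ : (n + 1) ^ cE ≤ 2 ^ (cE * q) := by
    calc (n + 1) ^ cE ≤ (2 ^ q) ^ cE :=
          Nat.pow_le_pow_left (Nat.lt_pow_succ_log_self one_lt_two _).le _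
      _ = 2 ^ (cE * q) := by rw [← pow_mul, mul_comm]
  have hGQ : G * (n + 1) ^ cE ≤ 2 ^ (g + cE * q) := by
    rw [pow_add]; exact Nat.mul_le_mul hGg hQ
  have h1 : G * (n + 1) ^ cE * 2 ^ (n - L) ≤ 2 ^ (n - L / 2 - 1) := by
    calc G * (n + 1) ^ cE * 2 ^ (n - L) ≤ 2 ^ (g + cE * q) * 2 ^ (n - L) :=
          Nat.mul_le_mul_right _ hGQ
      _ = 2 ^ (g + cE * q + (n - L)) := (pow_add _ _ _).symm
      _ ≤ 2 ^ (n - L / 2 - 1) := Nat.pow_le_pow_right two_pos (by omega)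
  have h2 : G * (n + 1) ^ cE * 2 ^ Z ≤ 2 ^ (n - L / 2 - 1) := by
    calc G * (n + 1) ^ cE * 2 ^ Z ≤ 2 ^ (g + cE * q) * 2 ^ Z := Nat.mul_le_mul_right _ hGQ
      _ = 2 ^ (g + cE * q + Z) := (pow_add _ _ _).symm
      _ ≤ 2 ^ (n - L / 2 - 1) := Nat.pow_le_pow_right two_pos (by omega)
  calc G * (n + 1) ^ cE * (2 ^ (n - L) + 2 ^ Z)
      = G * (n + 1) ^ cE * 2 ^ (n - L) + G * (n + 1) ^ cE * 2 ^ Z := Nat.mul_add _ _ _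
    _ ≤ 2 ^ (n - L / 2 - 1) + 2 ^ (n - L / 2 - 1) := Nat.add_le_add h1 h2
    _ = 2 ^ (n - L / 2) := by
        rw [← two_mul, ← pow_succ']
        congr 1
        omega

/-! ### Elementary growth lemmas -/

/-- Polynomials are eventually below `2^t`: `(A t + B)^r < 2^t` for all large `t`. [folklore] -/
theorem eventually_pow_lt_two_pow (A B r : ℕ) : ∃ t₀ : ℕ, ∀ t, t₀ ≤ t → (A * t + B) ^ r < 2 ^ t := by
  have hlo := isLittleO_pow_const_const_pow_of_one_lt (R := ℝ) r (one_lt_two)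
  set c : ℝ := 1 / (2 * ((A : ℝ) + B + 1) ^ r) with hc
  have hc0 : 0 < c := by positivity
  obtain ⟨t₁, ht₁⟩ := Filter.eventually_atTop.1 (hlo.def hc0)
  refine ⟨max t₁ 1, fun t ht => ?_⟩
  have ht1 : 1 ≤ t := (le_max_right _ _).trans ht
  have h := ht₁ t ((le_max_left _ _).trans ht)
  rw [Real.norm_of_nonneg (by positivity), Real.norm_of_nonneg (by positivity)] at h
  have hAB : ((A * t + B : ℕ) : ℝ) ≤ ((A : ℝ) + B + 1) * t := by
    have : (1 : ℝ) ≤ t := by exact_mod_cast ht1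
    push_cast
    nlinarith
  have key : (((A * t + B : ℕ) : ℝ)) ^ r < ((2 ^ t : ℕ) : ℝ) := by
    have h2 : (0 : ℝ) < 2 ^ t := by positivity
    calc (((A * t + B : ℕ) : ℝ)) ^ r ≤ (((A : ℝ) + B + 1) * t) ^ r :=
          pow_le_pow_left₀ (by positivity) hAB r
      _ = ((A : ℝ) + B + 1) ^ r * (t : ℝ) ^ r := mul_pow _ _ _
      _ ≤ ((A : ℝ) + B + 1) ^ r * (c * 2 ^ t) := mul_le_mul_of_nonneg_left h (by positivity)
      _ = 2 ^ t / 2 := by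
          rw [hc]
          have : (0 : ℝ) < ((A : ℝ) + B + 1) ^ r := by positivity
          field_simp
      _ < 2 ^ t := by linarith
      _ = ((2 ^ t : ℕ) : ℝ) := by push_cast; ring
  exact_mod_cast key

/-- `log₂` is eventually below every root: `A log₂ (n+1) + B ≤ ⌊n^{1/r}⌋` for all large `n`
(`r ≠ 0`). [folklore] -/
theorem eventually_log_le_nthRoot (A B : ℕ) {r : ℕ} (hr : r ≠ 0) :
    ∃ N : ℕ, ∀ n, N ≤ n → A * Nat.log 2 (n + 1) + B ≤ Nat.nthRoot r n := by
  obtain ⟨t₀, ht₀⟩ := eventually_pow_lt_two_pow A B r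
  refine ⟨2 ^ t₀, fun n hn => ?_⟩
  rw [Nat.le_nthRoot_iff hr]
  have ht : t₀ ≤ Nat.log 2 (n + 1) := Nat.le_log_of_pow_le one_lt_two (by omega)
  have h1 := ht₀ _ ht
  have h2 : 2 ^ Nat.log 2 (n + 1) ≤ n + 1 := Nat.pow_log_le_self 2 (by omega)
  omega

/-- `√n` is eventually small against `n`: `A ⌊√n⌋ + B ≤ n` for all large `n`. [folklore] -/
theorem eventually_sqrt_le (A B : ℕ) : ∃ N : ℕ, ∀ n, N ≤ n → A * Nat.sqrt n + B ≤ n := by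
  refine ⟨(A + B) ^ 2, fun n hn => ?_⟩
  have hs : A + B ≤ Nat.sqrt n := by rw [Nat.le_sqrt']; exact hn
  have hss : Nat.sqrt n * Nat.sqrt n ≤ n := Nat.sqrt_le n
  rcases Nat.eq_zero_or_pos (Nat.sqrt n) with h0 | hpos
  · rw [h0] at hs ⊢
    have hB : B = 0 := by omega
    rw [hB]; simp
  · calc A * Nat.sqrt n + B ≤ A * Nat.sqrt n + B * Nat.sqrt n :=
          Nat.add_le_add_left (Nat.le_mul_of_pos_right _ hpos) _
      _ = (A + B) * Nat.sqrt n := (Nat.add_mul _ _ _).symm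
      _ ≤ Nat.sqrt n * Nat.sqrt n := Nat.mul_le_mul_right _ hs
      _ ≤ n := hss

/-- `n^{1/k} < ⌊n^{1/k}⌋ + 1` as reals (`k ≠ 0`). [folklore] -/
theorem rpow_inv_lt_nthRoot_add_one {k : ℕ} (hk : k ≠ 0) (n : ℕ) :
    (n : ℝ) ^ ((k : ℝ)⁻¹) < (Nat.nthRoot k n : ℝ) + 1 := by
  have h := Nat.lt_pow_nthRoot_add_one hk n
  have h' : (n : ℝ) < ((Nat.nthRoot k n : ℝ) + 1) ^ k := by exact_mod_cast h
  calc (n : ℝ) ^ ((k : ℝ)⁻¹) < (((Nat.nthRoot k n : ℝ) + 1) ^ k) ^ ((k : ℝ)⁻¹) :=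
        Real.rpow_lt_rpow (Nat.cast_nonneg n) h' (by positivity)
    _ = (Nat.nthRoot k n : ℝ) + 1 := Real.pow_rpow_inv_natCast (by positivity) hk

/-- A size bound `s ≤ 2^{n^{1/k}}` (real) gives `s ≤ 2^{⌊n^{1/k}⌋ + 1}` (natural). [folklore] -/
theorem le_two_pow_nthRoot_succ {k n s : ℕ} (hk : k ≠ 0)
    (hs : (s : ℝ) ≤ 2 ^ ((n : ℝ) ^ ((k : ℝ)⁻¹))) : s ≤ 2 ^ (Nat.nthRoot k n + 1) := by
  have h1 : (2 : ℝ) ^ ((n : ℝ) ^ ((k : ℝ)⁻¹)) < (2 : ℝ) ^ ((Nat.nthRoot k n + 1 : ℕ) : ℝ) := by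
    refine Real.rpow_lt_rpow_of_exponent_lt one_lt_two ?_
    push_cast
    exact rpow_inv_lt_nthRoot_add_one hk n
  have h2 : (s : ℝ) < ((2 ^ (Nat.nthRoot k n + 1) : ℕ) : ℝ) := by
    rw [Nat.cast_pow, Nat.cast_two, ← Real.rpow_natCast]
    exact hs.trans_lt h1
  exact_mod_cast h2.le


/-! ### The largeness conditions hold eventually -/

/-- **Parameter analysis of Theorem 4.1** (Williams 2014, proof of Thm. 4.1, p. 16: "Set
`ℓ = n^{1/(2e)}` … in `O(2^{n-ℓ} · poly(n)) ≤ 2^{n-Ω(n^{1/(2e)})}` time"): if the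
restriction length `ℓ(n)` is within constant factors of `⌊n^{1/(2e)}⌋`, then for all large `n` the
two largeness conditions of `driverBound_le_two_pow` hold (with `Z = G u^e`,
`u = ℓ n + ⌊n^{1/(4e)}⌋ + log₂ n + 5`), `ℓ n ≤ n`, and `⌊n^{1/(2e)}⌋ ≥ 4K + 2`.
[cite: Williams2014, Thm. 4.1 (proof)] -/
theorem eventually_driver_conditions {e cE cP K N₀ : ℕ} (he : 1 ≤ e) (hK : 0 < K) {ℓ : ℕ → ℕ}
    (hℓ : ∀ n, N₀ ≤ n →
      Nat.nthRoot (2 * e) n ≤ K * ℓ n + K ∧ ℓ n ≤ K * Nat.nthRoot (2 * e) n + K) :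
    ∃ N : ℕ, ∀ n, N ≤ n →
      ℓ n ≤ n ∧
      Nat.log 2 (2 * cE + 2 * cP + 11) + 1 + cE * (Nat.log 2 (n + 1) + 1) + 1 + ℓ n / 2 ≤ ℓ n ∧
      Nat.log 2 (2 * cE + 2 * cP + 11) + 1 + cE * (Nat.log 2 (n + 1) + 1) +
          (2 * cE + 2 * cP + 11) * (ℓ n + Nat.nthRoot (4 * e) n + Nat.log 2 n + 5) ^ e +
          ℓ n / 2 + 1 ≤ n ∧
      4 * K + 2 ≤ Nat.nthRoot (2 * e) n := by
  set G := 2 * cE + 2 * cP + 11 with hG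
  set g := Nat.log 2 G + 1 with hg
  have h2e : 2 * e ≠ 0 := by omega
  obtain ⟨N₁, hN₁⟩ :=
    eventually_log_le_nthRoot (K * (2 * cE)) (K * (2 * g + 2 * cE + 3) + K) h2e
  obtain ⟨N₂, hN₂⟩ := eventually_log_le_nthRoot 1 (5 * K + 6) h2e
  obtain ⟨N₃, hN₃⟩ := eventually_sqrt_le (cE + G * (K + 3) ^ e + K + 1) (g + cE + K + 2)
  refine ⟨max (max N₀ N₁) (max N₂ N₃), fun n hn => ?_⟩
  have hn₀ : N₀ ≤ n := ((le_max_left _ _).trans (le_max_left _ _)).trans hn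
  have hn₁ : N₁ ≤ n := ((le_max_right _ _).trans (le_max_left _ _)).trans hn
  have hn₂ : N₂ ≤ n := ((le_max_left _ _).trans (le_max_right _ _)).trans hn
  have hn₃ : N₃ ≤ n := ((le_max_right _ _).trans (le_max_right _ _)).trans hn
  obtain ⟨hRL, hLR⟩ := hℓ n hn₀
  have h1 := hN₁ n hn₁
  have h2 := hN₂ n hn₂
  have h3 := hN₃ n hn₃
  set R := Nat.nthRoot (2 * e) n with hR
  set ρ := Nat.nthRoot (4 * e) n with hρ
  set L := ℓ n with hL
  set SQ := Nat.sqrt n with hSQ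
  set W := G * (K + 3) ^ e with hW
  set ql := Nat.log 2 (n + 1) + 1 with hql
  -- `⌊n^{1/(4e)}⌋ ≤ ⌊n^{1/(2e)}⌋ ≤ (⌊n^{1/(2e)}⌋)^e ≤ ⌊√n⌋`
  have hρR : ρ ≤ R := by
    rw [hR, Nat.le_nthRoot_iff h2e]
    have hρ4 : ρ ^ (4 * e) ≤ n := Nat.pow_nthRoot_le (Or.inl (by omega))
    rcases Nat.eq_zero_or_pos ρ with h0 | hpos
    · rw [h0, zero_pow h2e]; exact Nat.zero_le _
    · exact (Nat.pow_le_pow_right hpos (by omega)).trans hρ4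
  have hRsqrt : R ^ e ≤ SQ := by
    rw [hSQ, Nat.le_sqrt', ← pow_mul']
    exact Nat.pow_nthRoot_le (Or.inl h2e)
  have hRRe : R ≤ R ^ e := Nat.le_self_pow (by omega) R
  have hRSQ : R ≤ SQ := hRRe.trans hRsqrt
  have hlogn : Nat.log 2 n ≤ Nat.log 2 (n + 1) := Nat.log_mono_right (Nat.le_succ n)
  have hlogR : Nat.log 2 (n + 1) + (5 * K + 6) ≤ R := by simpa using h2
  -- `L` beats `log n`
  have hLZ : 2 * g + 2 * (cE * ql) + 3 ≤ L := by
    have hmul : K * (2 * g + 2 * (cE * ql) + 3) + K ≤ K * L + K := by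
      calc K * (2 * g + 2 * (cE * ql) + 3) + K
          = K * (2 * cE) * Nat.log 2 (n + 1) + (K * (2 * g + 2 * cE + 3) + K) := by
            rw [hql]; ring
        _ ≤ R := h1
        _ ≤ K * L + K := hRL
    have : K * (2 * g + 2 * (cE * ql) + 3) ≤ K * L := by omega
    exact Nat.le_of_mul_le_mul_left this hK
  -- `u ≤ (K + 3) ⌊n^{1/(2e)}⌋`, so `G u^e ≤ W ⌊√n⌋`
  have hu : L + ρ + Nat.log 2 n + 5 ≤ (K + 3) * R := by
    have : (K + 3) * R = K * R + 3 * R := by ring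
    rw [this]
    omega
  have hue : G * (L + ρ + Nat.log 2 n + 5) ^ e ≤ W * SQ := by
    calc G * (L + ρ + Nat.log 2 n + 5) ^ e ≤ G * ((K + 3) * R) ^ e :=
          Nat.mul_le_mul_left _ (Nat.pow_le_pow_left hu e)
      _ = W * R ^ e := by rw [hW, mul_pow]; ring
      _ ≤ W * SQ := Nat.mul_le_mul_left _ hRsqrt
  have h3' : cE * SQ + W * SQ + K * SQ + SQ + (g + cE + K + 2) ≤ n := by
    calc cE * SQ + W * SQ + K * SQ + SQ + (g + cE + K + 2)
        = (cE + W + K + 1) * SQ + (g + cE + K + 2) := by ring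
      _ ≤ n := h3
  have hKR : K * R ≤ K * SQ := Nat.mul_le_mul_left _ hRSQ
  have hcq : cE * ql ≤ cE * SQ + cE := by
    have : ql ≤ SQ + 1 := by rw [hql]; omega
    calc cE * ql ≤ cE * (SQ + 1) := Nat.mul_le_mul_left _ this
      _ = cE * SQ + cE := by ring
  refine ⟨?_, ?_, ?_, ?_⟩
  · omega
  · omega
  · omega
  · omega

/-- **The saving**: under the sandwich `⌊n^{1/(2e)}⌋ ≤ K L + K`, once `⌊n^{1/(2e)}⌋ ≥ 4K + 2`,
`2^{n - L/2} ≤ ⌊2^{n - n^{1/(2e)}/(4K)}⌋`. [cite: Williams2014, Thm. 4.1 (proof)] -/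
theorem two_pow_le_floor_rpow {e K L n : ℕ} (hK : 0 < K)
    (hRL : Nat.nthRoot (2 * e) n ≤ K * L + K) (hR : 4 * K + 2 ≤ Nat.nthRoot (2 * e) n)
    (he : 2 * e ≠ 0) (hLn : L / 2 ≤ n) :
    2 ^ (n - L / 2) ≤
      ⌊(2 : ℝ) ^ ((n : ℝ) - 1 / (4 * (K : ℝ)) * (n : ℝ) ^ (((2 * e : ℕ) : ℝ)⁻¹))⌋₊ := by
  set R := Nat.nthRoot (2 * e) n with hR_def
  have hδ : (n : ℝ) ^ (((2 * e : ℕ) : ℝ)⁻¹) < R + 1 := rpow_inv_lt_nthRoot_add_one he n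
  have hK' : (0 : ℝ) < K := by exact_mod_cast hK
  have hRL' : (R : ℝ) ≤ K * L + K := by exact_mod_cast hRL
  have hR' : 4 * (K : ℝ) + 2 ≤ R := by exact_mod_cast hR
  have hL2 : (L : ℝ) ≤ 2 * ((L / 2 : ℕ) : ℝ) + 1 := by
    have : L ≤ 2 * (L / 2) + 1 := by omega
    exact_mod_cast this
  have hKL2 : (K : ℝ) * L ≤ 2 * ((K : ℝ) * ((L / 2 : ℕ) : ℝ)) + K := by
    have := mul_le_mul_of_nonneg_left hL2 hK'.le
    linarith
  have key : 1 / (4 * (K : ℝ)) * (n : ℝ) ^ (((2 * e : ℕ) : ℝ)⁻¹) ≤ ((L / 2 : ℕ) : ℝ) := by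
    rw [one_div, inv_mul_le_iff₀ (by positivity)]
    linarith
  refine Nat.le_floor ?_
  rw [Nat.cast_pow, Nat.cast_two, ← Real.rpow_natCast]
  refine Real.rpow_le_rpow_of_exponent_le one_le_two ?_
  rw [Nat.cast_sub hLn]
  linarith

/-! ### Theorem 4.1 from its machines -/

/-- **Assembly of Williams' Theorem 4.1 from its components** (Williams 2014, proof of Thm. 4.1).
Hypotheses: the algorithmic conversion of Lemma 4.1 (`Williams2014_lemma_4_1`, named fact); an
evaluation machine as in Lemma 4.2, Proof 2 (Yates), correct on every `SYM⁺` circuit (the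
printed size hypothesis `s ≤ 2^{0.1n}` is only needed by Proof 1); a restriction-length function
`ℓ r n` within constant factors of `⌊n^{1/r}⌋` for large `n`; and for every modulus and `r` a
preprocessing machine printing the code of the OR of the `2^{ℓ r n}` restrictions
(`Circuit.orRestrictions`) in time polynomial in `2^{ℓ} (n + size + fan-in + 2)`. Conclusion:
`Williams2014_thm_4_1`, with `ε = 1/(4e)`, `δ = 1/(2e)` (`e ≥ 1` the exponent of Lemma 4.1 at
depth `d + 2`), `a = 1/(4(K+1))`: the driver `exists_accSat_driver` runs in time
`driverTime`, which is `≤ 2^{n - ℓ/2}` for large `n` (`driverTime_le`, `driverBound_le_two_pow`,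
`eventually_driver_conditions`), hence `≤ ⌊2^{n - a n^δ}⌋` (`two_pow_le_floor_rpow`); the finitely
many small `n` are absorbed by the additive constant (`AccSatInTime.of_le_of_bdd`).
[cite: Williams2014, Thm. 4.1 (proof)] -/
theorem Williams2014_thm_4_1_of_machines (h41 : Williams2014_lemma_4_1)
    (hE : ∃ (cE : ℕ) (E : TM2ComputableAux Bool Bool), ∀ (n : ℕ) (S : SymPlus n),
      E.OutputsWithin (encodeSymPlus S) (truthTable S.eval)
        (cE * (2 ^ n + S.size ^ cE) * (n + 1) ^ cE + cE))
    (ℓ : ℕ → ℕ → ℕ)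
    (hℓ : ∀ r, 0 < r → ∃ K N₀ : ℕ, ∀ n, N₀ ≤ n →
      Nat.nthRoot r n ≤ K * ℓ r n + K ∧ ℓ r n ≤ K * Nat.nthRoot r n + K)
    (hP : ∀ m r : ℕ, 2 ≤ m → 0 < r → ∃ (cP : ℕ) (P : TM2ComputableAux Bool Bool),
      ∀ (n : ℕ) (C : Circuit (Fin n)), C.IsOver (accBasis m) →
        P.OutputsWithin (encodeAccCircuit m C) (encodeAccCircuit m (C.orRestrictions (ℓ r n)))
          (cP * (2 ^ ℓ r n * (n + C.size + C.maxFanIn + 2)) ^ cP + cP)) :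
    Williams2014_thm_4_1 := by
  intro d m _hd hm
  obtain ⟨e₀, M, hM₀⟩ := h41 (d + 2) m hm
  -- exponent `e = max e₀ 1 ≥ 1`
  set e := max e₀ 1 with he_def
  have he : 1 ≤ e := le_max_right _ _
  have hM : ∀ (n s : ℕ) (C : Circuit (Fin n)), C.IsOver (accBasis m) → C.acDepth ≤ d + 2 → n ≤ s →
      C.size ≤ s → C.maxFanIn ≤ s →
        ∃ S : SymPlus n, S.size ≤ 2 ^ (Nat.log 2 s + 2) ^ e ∧
          S.maxFanIn ≤ (Nat.log 2 s + 2) ^ e ∧ (∀ x, S.eval x = C.eval x) ∧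
          M.OutputsWithin (encodeAccCircuit m C) (encodeSymPlus S) (2 ^ (Nat.log 2 s + 2) ^ e) := by
    intro n s C hO hdp hn hs hf
    obtain ⟨S, h1, h2, h3, h4⟩ := hM₀ n s C hO hdp hn hs hf
    have hpow : (Nat.log 2 s + 2) ^ e₀ ≤ (Nat.log 2 s + 2) ^ e :=
      Nat.pow_le_pow_right (by omega) (le_max_left _ _)
    exact ⟨S, h1.trans (Nat.pow_le_pow_right two_pos hpow), h2.trans hpow, h3,
      h4.mono (Nat.pow_le_pow_right two_pos hpow)⟩
  obtain ⟨cE, E, hE⟩ := hE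
  obtain ⟨cP, P, hP⟩ := hP m (2 * e) hm (by omega)
  obtain ⟨K, N₀, hKℓ⟩ := hℓ (2 * e) (by omega)
  have hKℓ' : ∀ n, N₀ ≤ n → Nat.nthRoot (2 * e) n ≤ (K + 1) * ℓ (2 * e) n + (K + 1) ∧
      ℓ (2 * e) n ≤ (K + 1) * Nat.nthRoot (2 * e) n + (K + 1) := fun n hn =>
    ⟨(hKℓ n hn).1.trans (Nat.add_le_add (Nat.mul_le_mul_right _ (Nat.le_succ K)) (Nat.le_succ K)),
      (hKℓ n hn).2.trans (Nat.add_le_add (Nat.mul_le_mul_right _ (Nat.le_succ K)) (Nat.le_succ K))⟩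
  obtain ⟨D, hD⟩ := exists_accSat_driver (d := d) (ℓ := ℓ (2 * e)) hM hE hP
  obtain ⟨N₁, hN₁⟩ := eventually_driver_conditions (cE := cE) (cP := cP) he (Nat.succ_pos K) hKℓ'
  refine ⟨((4 * e : ℕ) : ℝ)⁻¹, ((2 * e : ℕ) : ℝ)⁻¹, 1 / (4 * ((K + 1 : ℕ) : ℝ)),
    inv_pos.2 (by positivity), inv_lt_one_of_one_lt₀ (by norm_cast; omega),
    (inv_lt_inv₀ (by positivity) (by positivity)).2 (by norm_cast; omega), by positivity, ?_⟩
  intro s N hsN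
  -- the driver, with its raw time bound, on every instance
  have hraw : AccSatInTime d m s (fun n => driverTime e cE cP (ℓ (2 * e) n) n (s n)) :=
    ⟨1, D, fun n C hO hdp hs hf => (hD n (s n) C hO hdp hs hf).mono (by dsimp only; omega)⟩
  refine hraw.of_le_of_bdd (max (max N N₀) N₁)
    (∑ n ∈ Finset.range (max (max N N₀) N₁), driverTime e cE cP (ℓ (2 * e) n) n (s n))
    (fun n hn => ?_) (fun n hn => ?_)
  · obtain ⟨hLn, H1, H2, hR⟩ := hN₁ n ((le_max_right _ _).trans hn)
    have hnN : N ≤ n := ((le_max_left _ _).trans (le_max_left _ _)).trans hn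
    have hn₀ : N₀ ≤ n := ((le_max_right _ _).trans (le_max_left _ _)).trans hn
    have hs' : s n ≤ 2 ^ (Nat.nthRoot (4 * e) n + 1) :=
      le_two_pow_nthRoot_succ (by omega) (hsN n hnN)
    calc driverTime e cE cP (ℓ (2 * e) n) n (s n)
        ≤ (2 * cE + 2 * cP + 11) * (n + 1) ^ cE * (2 ^ (n - ℓ (2 * e) n) +
            2 ^ ((2 * cE + 2 * cP + 11) *
              (ℓ (2 * e) n + Nat.nthRoot (4 * e) n + Nat.log 2 n + 5) ^ e)) :=
          driverTime_le he hs'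
      _ ≤ 2 ^ (n - ℓ (2 * e) n / 2) := driverBound_le_two_pow hLn H1 H2
      _ ≤ _ := two_pow_le_floor_rpow (Nat.succ_pos K) (hKℓ' n hn₀).1 hR (by omega) (by omega)
  · exact Finset.single_le_sum (f := fun n => driverTime e cE cP (ℓ (2 * e) n) n (s n))
      (fun _ _ => Nat.zero_le _) (Finset.mem_range.2 hn)


/-- The same with the restriction length `ℓ = ⌊n^{1/r}⌋ = Nat.nthRoot r n` of the printed proof
("Set `ℓ = n^{1/(2e)}`"): then the sandwich hypothesis is void and the preprocessing machine
prints the OR of the `2^{⌊n^{1/r}⌋}` restrictions. [cite: Williams2014, Thm. 4.1 (proof)] -/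
theorem Williams2014_thm_4_1_of_machines_nthRoot (h41 : Williams2014_lemma_4_1)
    (hE : ∃ (cE : ℕ) (E : TM2ComputableAux Bool Bool), ∀ (n : ℕ) (S : SymPlus n),
      E.OutputsWithin (encodeSymPlus S) (truthTable S.eval)
        (cE * (2 ^ n + S.size ^ cE) * (n + 1) ^ cE + cE))
    (hP : ∀ m r : ℕ, 2 ≤ m → 0 < r → ∃ (cP : ℕ) (P : TM2ComputableAux Bool Bool),
      ∀ (n : ℕ) (C : Circuit (Fin n)), C.IsOver (accBasis m) →
        P.OutputsWithin (encodeAccCircuit m C)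
          (encodeAccCircuit m (C.orRestrictions (Nat.nthRoot r n)))
          (cP * (2 ^ Nat.nthRoot r n * (n + C.size + C.maxFanIn + 2)) ^ cP + cP)) :
    Williams2014_thm_4_1 :=
  Williams2014_thm_4_1_of_machines h41 hE (fun r n => Nat.nthRoot r n)
    (fun _ _ => ⟨1, 0, fun n _ => ⟨by omega, by omega⟩⟩) hP

/-- Hence the same machines give the polynomial-size form `Williams2014_accSat_polysize` consumed
by the proof of Thm. 1.1 (`Williams2014_accSat_polysize_of_thm_4_1`) and Murray–Williams'
`ε = 1/r` form (`MurrayWilliams2018_thm_5_1_of_thm_4_1`). [cite: Williams2014, Thm. 4.1 and proof of Thm. 1.1] -/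
theorem Williams2014_accSat_polysize_of_machines (h41 : Williams2014_lemma_4_1)
    (hE : ∃ (cE : ℕ) (E : TM2ComputableAux Bool Bool), ∀ (n : ℕ) (S : SymPlus n),
      E.OutputsWithin (encodeSymPlus S) (truthTable S.eval)
        (cE * (2 ^ n + S.size ^ cE) * (n + 1) ^ cE + cE))
    (hP : ∀ m r : ℕ, 2 ≤ m → 0 < r → ∃ (cP : ℕ) (P : TM2ComputableAux Bool Bool),
      ∀ (n : ℕ) (C : Circuit (Fin n)), C.IsOver (accBasis m) →
        P.OutputsWithin (encodeAccCircuit m C)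
          (encodeAccCircuit m (C.orRestrictions (Nat.nthRoot r n)))
          (cP * (2 ^ Nat.nthRoot r n * (n + C.size + C.maxFanIn + 2)) ^ cP + cP)) :
    Williams2014_accSat_polysize ∧ MurrayWilliams2018_thm_5_1 :=
  have h := Williams2014_thm_4_1_of_machines_nthRoot h41 hE hP
  ⟨Williams2014_accSat_polysize_of_thm_4_1 h, MurrayWilliams2018_thm_5_1_of_thm_4_1 h⟩

end Literature.Computability.Complexity
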